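import Summits.Ventures.PercRepro.ProfilePointedCircuitClassesStarNineDefectD

/-!
# PercRepro — THE TWO-PART SPLIT OF THE DEFECT BOUND, PART A: THE SECOND-KIND DEFECTS ARE PAID BY THE `f`-DEFECTS
(p5, gen 58; `proofs/P5-GM1.md` §86)

On a simple cosimple `N` with `#E = 9`, `ρ(E) = 5`, `e ≠ f` and `X := E − e − f`, an `e`-defect `τ` (`τ + e ∈ BI₄`,
`τ + f ∉ BI₄`) fails `τ + f ∈ BI₄` for one of two reasons: `K + e` is DEPENDENT (`K := X − τ`; the FIRST KIND, `tTwo`: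
`e ∈ cl K`, a hyperplane of `N` through `e` avoiding `f`) or `K + e` is a basis and `τ + f` is dependent (the SECOND
KIND, `tOneOnly`: `f ∈ cl τ`).  Likewise the `f`-defects split by whether `τ' + e` is independent (`fIndep`) or not
(`fDep`).  PARTS A AND B: **the second-kind `e`-defects inject (in the counting sense) into the `f`-defects with `τ' + e`
independent**, `#tOneOnly ≤ #fIndep` (part B, `card_tOneOnly_le_card_fIndep`), by ONE double count over the relation
`τ' ∩ τ = ∅`.  THIS PART holds the definitions of the four classes, the complement identities on `X`, the size bound of
cosimplicity (a set of rank `≤ 4` has `≤ 6` points), the facts carried by a defect, and THE PARTNER LEMMA: for a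
second-kind `τ` and `z ∈ K := X − τ` outside the hyperplane `cl(τ + e)`, the triple `K − z` is an `f`-defect with
`τ' + e` independent and disjoint from `τ` (`τ' + f ⊆ K + f` is independent, `X − τ' + e = τ + z + e` is a basis, and
`X − τ' + f ⊇ τ + f` is dependent).  Nothing here uses the structure of the first kind; the first-kind bound
`#tTwo ≤ #cPairs + #fDep` is the remaining content of (★)₉.
-/

open scoped Matroid

namespace PercRepro.Cogirth

open Finset ThmH Skew Shadow Profile

open Classical

variable {α : Type} [DecidableEq α] {N : Matroid α} [N.Finite]

section StarNineSplitA

/-- The `e`-defects of the FIRST KIND: `X − τ + e` is not a basis (`e ∈ cl(X − τ)`). -/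
noncomputable def tTwo (N : Matroid α) [N.Finite] (e f : α) : Finset (Finset α) :=
  (defTriples N e f e \ defTriples N e f f).filter
    (fun τ => ¬ rk N (insert e ((((gr N).erase e).erase f) \ τ)) = 5)

/-- The `e`-defects of the SECOND KIND: `X − τ + e` is a basis (so `τ + f` is dependent). -/
noncomputable def tOneOnly (N : Matroid α) [N.Finite] (e f : α) : Finset (Finset α) :=
  (defTriples N e f e \ defTriples N e f f).filter
    (fun τ => rk N (insert e ((((gr N).erase e).erase f) \ τ)) = 5)

/-- The `f`-defects with `τ' + e` dependent. -/
noncomputable def fDep (N : Matroid α) [N.Finite] (e f : α) : Finset (Finset α) :=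
  (defTriples N e f f \ defTriples N e f e).filter (fun τ => ¬ rk N (insert e τ) = 4)

/-- The `f`-defects with `τ' + e` independent. -/
noncomputable def fIndep (N : Matroid α) [N.Finite] (e f : α) : Finset (Finset α) :=
  (defTriples N e f f \ defTriples N e f e).filter (fun τ => rk N (insert e τ) = 4)

/-- `#D_e = #tTwo + #tOneOnly`. -/
theorem card_defects_eq_card_tTwo_add_card_tOneOnly (N : Matroid α) [N.Finite] (e f : α) :
    (defTriples N e f e \ defTriples N e f f).card = (tTwo N e f).card + (tOneOnly N e f).card := by
  unfold tTwo tOneOnly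
  rw [add_comm, card_filter_add_card_filter_not]

/-- `#D_f = #fDep + #fIndep`. -/
theorem card_fdefects_eq_card_fDep_add_card_fIndep (N : Matroid α) [N.Finite] (e f : α) :
    (defTriples N e f f \ defTriples N e f e).card = (fDep N e f).card + (fIndep N e f).card := by
  unfold fDep fIndep
  rw [add_comm, card_filter_add_card_filter_not]

/-- `X ⊆ E`. -/
theorem X_subset_gr (N : Matroid α) [N.Finite] (e f : α) : ((gr N).erase e).erase f ⊆ gr N :=
  (erase_subset _ _).trans (erase_subset _ _)

/-- `#X = 7`. -/
theorem card_X (hn : (gr N).card = 9) {e f : α} (he : e ∈ gr N) (hf : f ∈ gr N) (hef : e ≠ f) :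
    (((gr N).erase e).erase f).card = 7 := by
  rw [card_erase_of_mem (mem_erase.2 ⟨hef.symm, hf⟩), card_erase_of_mem he, hn]

/-- `E − (τ + e) = (X − τ) + f` for `τ ⊆ X`. -/
theorem gr_sdiff_insert_e_of_subset_X {e f : α} (hf : f ∈ gr N) (hef : e ≠ f) {τ : Finset α}
    (hτX : τ ⊆ ((gr N).erase e).erase f) :
    gr N \ insert e τ = insert f ((((gr N).erase e).erase f) \ τ) := by
  have hfτ : f ∉ τ := fun h => (mem_erase.1 (hτX h)).1 rfl
  ext a
  simp only [mem_sdiff, mem_insert, mem_erase, not_or]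
  constructor
  · rintro ⟨hag, hae, haτ⟩
    by_cases haf : a = f
    · exact Or.inl haf
    · exact Or.inr ⟨⟨haf, hae, hag⟩, haτ⟩
  · rintro (rfl | ⟨⟨haf, hae, hag⟩, haτ⟩)
    · exact ⟨hf, hef.symm, hfτ⟩
    · exact ⟨hag, hae, haτ⟩

/-- `E − (τ + f) = (X − τ) + e` for `τ ⊆ X`. -/
theorem gr_sdiff_insert_f_of_subset_X {e f : α} (he : e ∈ gr N) (hef : e ≠ f) {τ : Finset α}
    (hτX : τ ⊆ ((gr N).erase e).erase f) :
    gr N \ insert f τ = insert e ((((gr N).erase e).erase f) \ τ) := by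
  have heτ : e ∉ τ := fun h => (mem_erase.1 (mem_erase.1 (hτX h)).2).1 rfl
  ext a
  simp only [mem_sdiff, mem_insert, mem_erase, not_or]
  constructor
  · rintro ⟨hag, haf, haτ⟩
    by_cases hae : a = e
    · exact Or.inl hae
    · exact Or.inr ⟨⟨haf, hae, hag⟩, haτ⟩
  · rintro (rfl | ⟨⟨haf, hae, hag⟩, haτ⟩)
    · exact ⟨he, hef, heτ⟩
    · exact ⟨hag, haf, haτ⟩

/-- `E − (π + e + f) = X − π` for `π ⊆ X`. -/
theorem gr_sdiff_insert_ef_of_subset_X {e f : α} {π : Finset α}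
    (hπX : π ⊆ ((gr N).erase e).erase f) :
    gr N \ insert e (insert f π) = (((gr N).erase e).erase f) \ π := by
  have heπ : e ∉ π := fun h => (mem_erase.1 (mem_erase.1 (hπX h)).2).1 rfl
  have hfπ : f ∉ π := fun h => (mem_erase.1 (hπX h)).1 rfl
  ext a
  simp only [mem_sdiff, mem_insert, mem_erase, not_or]
  constructor
  · rintro ⟨hag, hae, haf, haπ⟩
    exact ⟨⟨haf, hae, hag⟩, haπ⟩
  · rintro ⟨⟨haf, hae, hag⟩, haπ⟩
    exact ⟨hag, hae, haf, haπ⟩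

/-- **COSIMPLICITY AS A SIZE BOUND**: a set of rank `≤ 4` has at most `6` points. -/
theorem card_le_six_of_rk_le_four (hn : (gr N).card = 9)
    (hcos : ∀ x ∈ gr N, ∀ y ∈ gr N, x ≠ y → rk N (((gr N).erase x).erase y) = 5) {S : Finset α} (hS : S ⊆ gr N)
    (hr : rk N S ≤ 4) : S.card ≤ 6 := by
  by_contra hcon
  rw [not_le] at hcon
  -- the complement `E − S` has at most two points: cover it by a pair `{x, y}`
  have hcard : (gr N \ S).card ≤ 2 := by
    rw [card_sdiff_of_subset hS, hn]; omega
  obtain ⟨u, hRu, hug, hu2⟩ := exists_subsuperset_card_eq (sdiff_subset : gr N \ S ⊆ gr N) hcard (by rw [hn]; norm_num)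
  obtain ⟨x, y, hxy, rfl⟩ := card_eq_two.1 hu2
  have hx : x ∈ gr N := hug (mem_insert_self _ _)
  have hy : y ∈ gr N := hug (mem_insert_of_mem (mem_singleton_self _))
  have hsub : ((gr N).erase x).erase y ⊆ S := by
    intro a ha
    rw [mem_erase, mem_erase] at ha
    by_contra haS
    have : a ∈ gr N \ S := mem_sdiff.2 ⟨ha.2.2, haS⟩
    have := hRu this
    rw [mem_insert, mem_singleton] at this
    rcases this with h | h
    · exact ha.2.1 h
    · exact ha.1 h
  have h1 := hcos x hx y hy hxy
  have h2 := rk_mono' (M := N) hsub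
  omega


/-- `ρ(S + z) ≤ ρ(S) + 1`. -/
theorem rk_insert_le_succ {z : α} (hz : z ∈ gr N) {S : Finset α} (hS : S ⊆ gr N) :
    rk N (insert z S) ≤ rk N S + 1 := by
  rw [rk_insert_eq hz hS]
  split_ifs <;> omega

/-- **THE FACTS OF AN `e`-DEFECT**: `τ ⊆ X`, `#τ = 3`, `ρ(τ + e) = 4`, `ρ((X − τ) + f) = 5`, `ρ(X − τ) = 4`,
`#(X − τ) = 4`, and `τ + f ∉ BI₄`. -/
theorem edefect_facts (hn : (gr N).card = 9) {e f : α} (he : e ∈ gr N) (hf : f ∈ gr N) (hef : e ≠ f) {τ : Finset α}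
    (hτ : τ ∈ defTriples N e f e \ defTriples N e f f) :
    τ ⊆ ((gr N).erase e).erase f ∧ τ.card = 3 ∧ rk N (insert e τ) = 4 ∧
      rk N (insert f ((((gr N).erase e).erase f) \ τ)) = 5 ∧ rk N ((((gr N).erase e).erase f) \ τ) = 4 ∧
      ((((gr N).erase e).erase f) \ τ).card = 4 ∧ insert f τ ∉ biIndepSets N 4 := by
  rw [mem_sdiff] at hτ
  obtain ⟨hτe, hτf⟩ := hτ
  unfold defTriples at hτe hτf
  rw [mem_filter, mem_powersetCard] at hτe
  obtain ⟨⟨hτX, hτ3⟩, hbi⟩ := hτe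
  have hτf' : insert f τ ∉ biIndepSets N 4 := by
    intro h
    exact hτf (by rw [mem_filter, mem_powersetCard]; exact ⟨⟨hτX, hτ3⟩, h⟩)
  obtain ⟨_, _, hrk, hcompl⟩ := mem_biIndepSets.1 hbi
  have heτ : e ∉ τ := fun h => (mem_erase.1 (mem_erase.1 (hτX h)).2).1 rfl
  have hK : (((gr N).erase e).erase f \ τ).card = 4 := by
    rw [card_sdiff_of_subset hτX, card_X hn he hf hef, hτ3]
  have hfK : f ∉ (((gr N).erase e).erase f) \ τ := fun h => (mem_erase.1 (mem_sdiff.1 h).1).1 rfl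
  rw [gr_sdiff_insert_e_of_subset_X hf hef hτX, card_insert_of_notMem hfK, hK] at hcompl
  refine ⟨hτX, hτ3, ?_, hcompl, ?_, hK, hτf'⟩
  · rw [hrk, card_insert_of_notMem heτ, hτ3]
  · have := rk_eq_card_of_subset_of_rk_eq_card (M := N) (subset_insert f _) (by rw [hcompl, card_insert_of_notMem hfK, hK])
    rw [this, hK]

/-- **THE FACTS OF AN `f`-DEFECT**: `τ' ⊆ X`, `#τ' = 3`, `ρ(τ' + f) = 4`, `ρ((X − τ') + e) = 5`, `ρ(X − τ') = 4`,
`#(X − τ') = 4`, and `τ' + e ∉ BI₄`. -/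
theorem fdefect_facts (hn : (gr N).card = 9) {e f : α} (he : e ∈ gr N) (hf : f ∈ gr N) (hef : e ≠ f) {τ : Finset α}
    (hτ : τ ∈ defTriples N e f f \ defTriples N e f e) :
    τ ⊆ ((gr N).erase e).erase f ∧ τ.card = 3 ∧ rk N (insert f τ) = 4 ∧
      rk N (insert e ((((gr N).erase e).erase f) \ τ)) = 5 ∧ rk N ((((gr N).erase e).erase f) \ τ) = 4 ∧
      ((((gr N).erase e).erase f) \ τ).card = 4 ∧ insert e τ ∉ biIndepSets N 4 := by
  rw [mem_sdiff] at hτ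
  obtain ⟨hτf, hτe⟩ := hτ
  unfold defTriples at hτe hτf
  rw [mem_filter, mem_powersetCard] at hτf
  obtain ⟨⟨hτX, hτ3⟩, hbi⟩ := hτf
  have hτe' : insert e τ ∉ biIndepSets N 4 := by
    intro h
    exact hτe (by rw [mem_filter, mem_powersetCard]; exact ⟨⟨hτX, hτ3⟩, h⟩)
  obtain ⟨_, _, hrk, hcompl⟩ := mem_biIndepSets.1 hbi
  have hfτ : f ∉ τ := fun h => (mem_erase.1 (hτX h)).1 rfl
  have hK : (((gr N).erase e).erase f \ τ).card = 4 := by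
    rw [card_sdiff_of_subset hτX, card_X hn he hf hef, hτ3]
  have heK : e ∉ (((gr N).erase e).erase f) \ τ := fun h => (mem_erase.1 (mem_erase.1 (mem_sdiff.1 h).1).2).1 rfl
  rw [gr_sdiff_insert_f_of_subset_X he hef hτX, card_insert_of_notMem heK, hK] at hcompl
  refine ⟨hτX, hτ3, ?_, hcompl, ?_, hK, hτe'⟩
  · rw [hrk, card_insert_of_notMem hfτ, hτ3]
  · have := rk_eq_card_of_subset_of_rk_eq_card (M := N) (subset_insert e _) (by rw [hcompl, card_insert_of_notMem heK, hK])
    rw [this, hK]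

/-- For a second-kind `e`-defect `τ`, `τ + f` has rank `≤ 3` (the only way `τ + f ∉ BI₄` can fail when `X − τ + e`
is a basis). -/
theorem rk_insert_f_le_three_of_tOneOnly (hn : (gr N).card = 9) {e f : α} (he : e ∈ gr N) (hf : f ∈ gr N)
    (hef : e ≠ f) {τ : Finset α} (hτ : τ ∈ tOneOnly N e f) : rk N (insert f τ) ≤ 3 := by
  unfold tOneOnly at hτ
  rw [mem_filter] at hτ
  obtain ⟨hτD, hKe⟩ := hτ
  obtain ⟨hτX, hτ3, _, _, _, hK, hnot⟩ := edefect_facts hn he hf hef hτD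
  have hfτ : f ∉ τ := fun h => (mem_erase.1 (hτX h)).1 rfl
  have heK : e ∉ (((gr N).erase e).erase f) \ τ := fun h => (mem_erase.1 (mem_erase.1 (mem_sdiff.1 h).1).2).1 rfl
  by_contra hcon
  rw [not_le] at hcon
  have hle := rk_le_card (M := N) (insert f τ)
  rw [card_insert_of_notMem hfτ, hτ3] at hle
  apply hnot
  rw [mem_biIndepSets]
  refine ⟨insert_subset hf (hτX.trans (X_subset_gr N e f)), by rw [card_insert_of_notMem hfτ, hτ3], ?_, ?_⟩
  · rw [card_insert_of_notMem hfτ, hτ3]; omega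
  · rw [gr_sdiff_insert_f_of_subset_X he hef hτX, hKe, card_insert_of_notMem heK, hK]

/-- `X − ((X − τ) − z) = τ + z` for `τ ⊆ X`, `z ∈ X − τ`. -/
theorem X_sdiff_erase_sdiff {X τ : Finset α} (hτX : τ ⊆ X) {z : α} (hz : z ∈ X \ τ) :
    X \ ((X \ τ).erase z) = insert z τ := by
  ext a
  simp only [mem_sdiff, mem_erase, mem_insert, not_and, not_not]
  constructor
  · rintro ⟨haX, h⟩
    by_cases haz : a = z
    · exact Or.inl haz
    · exact Or.inr (h haz haX)
  · rintro (rfl | haτ)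
    · exact ⟨(mem_sdiff.1 hz).1, fun h _ => absurd rfl h⟩
    · exact ⟨hτX haτ, fun _ _ => haτ⟩

/-- **A PARTNER OF A SECOND-KIND `e`-DEFECT**: for `z ∈ X − τ` outside `cl(τ + e)`, the triple `(X − τ) − z` is an
`f`-defect with `τ' + e` independent, disjoint from `τ`. -/
theorem partner_mem_fIndep (hn : (gr N).card = 9) {e f : α} (he : e ∈ gr N) (hf : f ∈ gr N) (hef : e ≠ f)
    {τ : Finset α} (hτ : τ ∈ tOneOnly N e f) {z : α} (hz : z ∈ (((gr N).erase e).erase f) \ τ)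
    (hzcl : z ∉ clF N (insert e τ)) :
    ((((gr N).erase e).erase f) \ τ).erase z ∈ fIndep N e f ∧
      Disjoint (((((gr N).erase e).erase f) \ τ).erase z) τ := by
  have hτ' := hτ
  unfold tOneOnly at hτ'
  rw [mem_filter] at hτ'
  obtain ⟨hτD, hKe⟩ := hτ'
  obtain ⟨hτX, hτ3, hrkτe, hrkKf, hrkK, hK, _⟩ := edefect_facts hn he hf hef hτD
  have hrkτf := rk_insert_f_le_three_of_tOneOnly hn he hf hef hτ
  set X := ((gr N).erase e).erase f with hXdef
  set K := X \ τ with hKdef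
  have hXg : X ⊆ gr N := X_subset_gr N e f
  have hKX : K ⊆ X := sdiff_subset
  have hτ'X : K.erase z ⊆ X := (erase_subset _ _).trans hKX
  have hτ'3 : (K.erase z).card = 3 := by rw [card_erase_of_mem hz, hK]
  have hzg : z ∈ gr N := hXg (hKX hz)
  have hzτ : z ∉ τ := (mem_sdiff.1 hz).2
  have heτ : e ∉ τ := fun h => (mem_erase.1 (mem_erase.1 (hτX h)).2).1 rfl
  have hfτ : f ∉ τ := fun h => (mem_erase.1 (hτX h)).1 rfl
  have hfK : f ∉ K.erase z := fun h => (mem_erase.1 (mem_sdiff.1 (mem_of_mem_erase h)).1).1 rfl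
  have heK : e ∉ K.erase z := fun h => (mem_erase.1 (mem_erase.1 (mem_sdiff.1 (mem_of_mem_erase h)).1).2).1 rfl
  have hze : z ≠ e := (mem_erase.1 (mem_erase.1 (hKX hz)).2).1
  have hzf : z ≠ f := fun h => (mem_erase.1 (hKX hz)).1 h
  have hcompl : X \ K.erase z = insert z τ := X_sdiff_erase_sdiff hτX hz
  -- `τ' + f` is independent: a subset of the basis `K + f`
  have h1 : rk N (insert f (K.erase z)) = 4 := by
    have := rk_eq_card_of_subset_of_rk_eq_card (M := N)
      (insert_subset_insert f (erase_subset z K) : insert f (K.erase z) ⊆ insert f K)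
      (by rw [hrkKf, card_insert_of_notMem (fun h => (mem_erase.1 (mem_sdiff.1 h).1).1 rfl), hK])
    rw [this, card_insert_of_notMem hfK, hτ'3]
  -- `τ' + e` is independent: a subset of the basis `K + e`
  have h2 : rk N (insert e (K.erase z)) = 4 := by
    have := rk_eq_card_of_subset_of_rk_eq_card (M := N)
      (insert_subset_insert e (erase_subset z K) : insert e (K.erase z) ⊆ insert e K)
      (by rw [hKe, card_insert_of_notMem (fun h => (mem_erase.1 (mem_erase.1 (mem_sdiff.1 h).1).2).1 rfl), hK])
    rw [this, card_insert_of_notMem heK, hτ'3]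
  -- the complement of `τ' + f` is `τ + z + e`, a basis
  have h3 : rk N (insert e (insert z τ)) = 5 := by
    rw [Finset.insert_comm, rk_insert_of_notMem_clF' hzg (insert_subset he (hτX.trans hXg)) hzcl, hrkτe]
  -- the complement of `τ' + e` is `τ + z + f`, of rank `≤ 4`
  have h4 : rk N (insert f (insert z τ)) ≤ 4 := by
    rw [Finset.insert_comm]
    have := rk_insert_le_succ hzg (insert_subset hf (hτX.trans hXg)) (N := N)
    omega
  have hzτe : z ∉ insert e τ := by rw [mem_insert, not_or]; exact ⟨hze, hzτ⟩
  have hzτf : z ∉ insert f τ := by rw [mem_insert, not_or]; exact ⟨hzf, hzτ⟩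
  have hcardτz : (insert z τ).card = 4 := by rw [card_insert_of_notMem hzτ, hτ3]
  have hezτ : e ∉ insert z τ := by rw [mem_insert, not_or]; exact ⟨hze.symm, heτ⟩
  have hfzτ : f ∉ insert z τ := by rw [mem_insert, not_or]; exact ⟨hzf.symm, hfτ⟩
  refine ⟨?_, ?_⟩
  · unfold fIndep
    rw [mem_filter, mem_sdiff]
    refine ⟨⟨?_, ?_⟩, h2⟩
    · unfold defTriples
      rw [mem_filter, mem_powersetCard, mem_biIndepSets]
      refine ⟨⟨hτ'X, hτ'3⟩, insert_subset hf (hτ'X.trans hXg), by rw [card_insert_of_notMem hfK, hτ'3], ?_, ?_⟩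
      · rw [h1, card_insert_of_notMem hfK, hτ'3]
      · rw [gr_sdiff_insert_f_of_subset_X he hef hτ'X, hcompl, h3, card_insert_of_notMem hezτ, hcardτz]
    · unfold defTriples
      rw [mem_filter, mem_powersetCard, mem_biIndepSets]
      rintro ⟨-, -, -, -, hc⟩
      rw [gr_sdiff_insert_e_of_subset_X hf hef hτ'X, hcompl, card_insert_of_notMem hfzτ, hcardτz] at hc
      omega
  · exact Disjoint.mono_left (erase_subset z K) sdiff_disjoint

end StarNineSplitA

end PercRepro.Cogirth
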